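import Summits.Ventures.CertifiedQuantumChemistry.Hamiltonians.HubbardRingTV
import Literature.MathematicalPhysics.QuantumChemistry.RelaxationEnergyHierarchy
import Literature.MathematicalPhysics.QuantumChemistry.SingletRestrictedRelaxation
import HarnessLib
import HarnessLib.Audit

/-!
# Ventures/CertifiedQuantumChemistry — Rows/ConjectureSU.lean: the strong-coupling conjecture S-U (a conjecture LEAF)

HONEST FRAMING (verbatim):
certified bounds for a stated model Hamiltonian in a stated basis; not a claim about the real molecule beyond that model.

This file is a CONJECTURE LEAF beside the rows: it holds NOTHING but the two `@[conjecture]` obligation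
nodes `ConjectureSU_DQG`, `ConjectureSU_DQGS2` (one `Prop` per two-positivity level X), their
conjunction `ConjectureSU`, and the two spelling `abbrev`s `Model.pqgSectorEnergy` /
`Model.pqgSingletEnergy` (which only feed the Literature value functions the model's `ℂ`-cast integral
tables, exactly as `Model.hamiltonian` feeds `molecularHamiltonian`). No theorem, no certificate, no row.
It types the lead's DRAFT v0.1 sentence (S-U) of `run/shared/lean/pub/pub-qchem/STRUCTURE.md` §2 AS
REGISTERED — a conjecture OFFERED FOR ATTACK, decided only by refereed rows of `CERTIFIED.md`, never by
a float; an eventual proof (`ConjectureSU…_holds`) or refutation (a theorem `¬ ConjectureSU…`) lands in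
a SIBLING file, never as an edit of this leaf (typing plan of record: STRUCTURE §2.3.1 (a)–(e) = the
typer's MEMO T-SU, HOME/INBOX L648; the lead's word RULINGS TYP-42 (b); acceptance list
`pub-qchem-lead/tools-g50/tsu/CHECKLIST-TSU.txt` 1b0cec8ea3ba4c1c).

(S-U), as printed (STRUCTURE §2, byte-identical in every v0.1.x; cited v0.1.9 sha16 94b59734467be6e9,
current v0.1.10 dedb79e4cf6b1032; bib key `PubQchemStructure2026` of `lean/references.bib` registers that
internal document — NOT a publication — solely as the place where this open conjecture is stated): «For the half-filled Hubbard ring with an even number L ≥ 4 of sites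
and for each two-positivity level X ∈ {DQG on the S_z = 0 sector, DQG + the scalar row ⟨Ŝ²⟩ = 0}, the
scaled relaxation gap (U/4t²)·(E₀(L;U) − OPT_X(L;U)) converges as U/t → ∞ to a finite limit
c_X(L) ≥ 0 — the gap of the level-X relaxation measured in units of the superexchange J = 4t²/U — with
c_DQG+S²(4) = 0, c_DQG(4) ∈ [0.39, 0.42], c_DQG+S²(6) ∈ [1.00, 1.05], c_DQG(6) ∈ [1.18, 1.25]; and
c_X(L)/L is non-decreasing in even L, so that at strong coupling the two-positivity relaxations miss a
NON-VANISHING fraction of the superexchange energy per site on every ring L ≥ 6 (…), although they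
miss none of it (with the spin row) on L = 4.» The closing 'so that …' gloss is a consequence of the
clauses typed below and is not typed separately.

Typing choices (§2.3.1): L = 2n, n ≥ 2; t = 1 is FIXED by the model files, so 'U/t → ∞' is U → ∞
ALONG ℚ (`Filter.atTop : Filter ℚ`; the model `hubbardRingTV (2n) 1 U` exists only at rational data,
ruling K2); E₀ is the SECTOR spelling `Model.energy (hubbardRingTV (2*n) 1 U) n n` (no hypothesis
needed; it equals the singlet energy on these files by `Rows/LiebSingletBridge`, not used here);
OPT_DQG = `Model.pqgSectorEnergy _ n n`, OPT_DQG+S² = `Model.pqgSingletEnergy _ n` (the `sInf` VALUE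
functions of `Literature/…/RelaxationEnergyHierarchy.lean` / `…/SingletRestrictedRelaxation.lean`);
the scaled gap is `((U : ℝ) / 4) * (E₀ − OPT_X)` (single cast ℚ → ℝ; factor U/4 = U/4t² at t = 1);
c_X is ONE function `c : ℕ → ℝ` per level (c n = c_X(2n)), so that the per-site clause
`c n / (2n) ≤ c (n+1) / (2n+2)` compares it across L; the interval clauses are closed intervals with
the registered rational endpoints. (Identified candidate c_DQG(4) = √2 − 1 (STRUCTURE 2.2.9, reading
grade) — not part of the conjecture.)

Typer `pub-qchem-typer` (gen 18), 0 core-h.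
-/

noncomputable section

namespace Summit.Ventures.CertifiedQuantumChemistry

open Summit.Ventures.CertifiedQuantumChemistry.Hamiltonians

namespace Model

variable {k : ℕ}

/-- Spelling only: `E_PQG(H_F; a, b)` — the optimal value of the `D, Q, G` programme with the sector rows
`(N_α, N_β) = (a, b)` (`Literature.MathematicalPhysics.QuantumChemistry.pqgSectorEnergy`) on the model's
`ℂ`-cast integral tables, the three casts of `Model.hamiltonian`. -/
abbrev pqgSectorEnergy (F : Model k) (a b : ℕ) : ℝ :=
  Literature.MathematicalPhysics.QuantumChemistry.pqgSectorEnergy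
    (fun p q => (F.h p q : ℂ)) (fun p q r s => (F.eri p q r s : ℂ)) (F.ecore : ℂ) a b

/-- Spelling only: `E_PQG(H_F; N = 2n, ⟨Ŝ²⟩ = 0)` — the optimal value of the singlet-restricted `D, Q, G`
programme (`Literature.MathematicalPhysics.QuantumChemistry.pqgSingletEnergy`) on the model's `ℂ`-cast
integral tables, the three casts of `Model.hamiltonian`. -/
abbrev pqgSingletEnergy (F : Model k) (n : ℕ) : ℝ :=
  Literature.MathematicalPhysics.QuantumChemistry.pqgSingletEnergy
    (fun p q => (F.h p q : ℂ)) (fun p q r s => (F.eri p q r s : ℂ)) (F.ecore : ℂ) n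

end Model

/-- **Conjecture S-U, level X = DQG on the `S_z = 0` sector** (HOME/STRUCTURE.md §2, DRAFT v0.1, offered
for attack): there is ONE function `c = c_DQG(2·) : ℕ → ℝ` such that for every `n ≥ 2` (ring `L = 2n`,
`t = 1`, half filling, sector `(n, n)`) `0 ≤ c n` and the scaled gap
`(U/4)·(E₀(2n;U) − E_PQG^sector(2n;U))` tends to `c n` as `U → ∞` along `ℚ`; `c n / (2n)` is
non-decreasing in `n`; `c 2 ∈ [39/100, 42/100]` and `c 3 ∈ [118/100, 125/100]`.
[cite: PubQchemStructure2026, HOME/STRUCTURE.md v0.1.9 94b59734467be6e9 §2 (S-U) + §2.3.1] -/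
@[conjecture] def ConjectureSU_DQG : Prop :=
  ∃ c : ℕ → ℝ,
    (∀ n, 2 ≤ n → 0 ≤ c n ∧
      Filter.Tendsto (fun U : ℚ => ((U : ℝ) / 4) *
          (Model.energy (hubbardRingTV (2*n) 1 U) n n - Model.pqgSectorEnergy (hubbardRingTV (2*n) 1 U) n n))
        Filter.atTop (nhds (c n))) ∧
    (∀ n, 2 ≤ n → c n / (2*n) ≤ c (n+1) / (2*n+2)) ∧
    c 2 ∈ Set.Icc (39/100) (42/100) ∧ c 3 ∈ Set.Icc (118/100) (125/100)

/-- **Conjecture S-U, level X = DQG + the scalar row `⟨Ŝ²⟩ = 0`** (HOME/STRUCTURE.md §2, DRAFT v0.1,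
offered for attack): there is ONE function `c = c_DQG+S²(2·) : ℕ → ℝ` such that for every `n ≥ 2` (ring
`L = 2n`, `t = 1`, half filling) `0 ≤ c n` and the scaled gap `(U/4)·(E₀(2n;U) − E_PQG^singlet(2n;U))`
(E₀ in the SECTOR spelling `(n, n)`) tends to `c n` as `U → ∞` along `ℚ`; `c n / (2n)` is non-decreasing
in `n`; `c 2 = 0` and `c 3 ∈ [1, 105/100]`.
[cite: PubQchemStructure2026, HOME/STRUCTURE.md v0.1.9 94b59734467be6e9 §2 (S-U) + §2.3.1] -/
@[conjecture] def ConjectureSU_DQGS2 : Prop :=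
  ∃ c : ℕ → ℝ,
    (∀ n, 2 ≤ n → 0 ≤ c n ∧
      Filter.Tendsto (fun U : ℚ => ((U : ℝ) / 4) *
          (Model.energy (hubbardRingTV (2*n) 1 U) n n - Model.pqgSingletEnergy (hubbardRingTV (2*n) 1 U) n))
        Filter.atTop (nhds (c n))) ∧
    (∀ n, 2 ≤ n → c n / (2*n) ≤ c (n+1) / (2*n+2)) ∧
    c 2 = 0 ∧ c 3 ∈ Set.Icc 1 (105/100)

/-- **Conjecture S-U** (HOME/STRUCTURE.md §2, DRAFT v0.1, offered for attack) = the conjunction of its two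
levels `ConjectureSU_DQG ∧ ConjectureSU_DQGS2`.
[cite: PubQchemStructure2026, HOME/STRUCTURE.md v0.1.9 94b59734467be6e9 §2 (S-U) + §2.3.1] -/
@[conjecture] def ConjectureSU : Prop := ConjectureSU_DQG ∧ ConjectureSU_DQGS2

end Summit.Ventures.CertifiedQuantumChemistry

end
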